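import Mathlib
import Literature.Analysis.FluidPDE.VorticityCalculus
import Literature.Analysis.FluidPDE.EnergyUniqueness
import Summits.NavierStokesRegularity.NavierStokesRegularity.Theorems.SlicedKelvinDefs
import Summits.NavierStokesRegularity.NavierStokesRegularity.Theorems.SlicedKelvinPlanarFluxAPrioriSqrtReg

/-!
# Crux `SlicedKelvin.PlanarFluxAPriori` (stmt-NavierStokesRegularity-15600), line `registered`:
  decay of the fold-law integrands along a field with cubic decay (helper for `stub_foldLawPackage`)

For a smooth field `v : ℝ³ → ℝ³` with `(1 + ‖x‖)³ ‖Dᵏv(x)‖ ≤ C`, `k ≤ 3` (the decay hypothesis of the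
registered stub `stub_foldLawPackage`, delivered along the solution by `stub_decayPersistence`), a frame
`R` (unit normal `n = R e₂`) and `ε > 0`, every integrand of the ε-fold-law subsolution package
`Theorems.SlicedKelvin.FoldLawSubsolution` is bounded by an explicit constant times `(1 + ‖x‖)⁻³`
(`κ = ‖curlCLM‖`, `f = ⟪curl v, n⟫`, `F_ε(f) = √(f² + ε²)`):

* `F_ε(f) − ε`, `D(F_ε∘f)`, `D(D(F_ε∘f)[n])` — by `κC`, `κC`, `κC + ε⁻¹(κC)²`;
* the vorticity tendency `w = νΔω − (v·∇)ω + (ω·∇)v` — by `3|ν|κC + 2κC²` (`norm_tendency_le_decay`),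
  hence the time density `F_ε'(f)⟪w, n⟫`;
* the annihilation density `F_ε''(f)|∇f|²` — by `3ε⁻¹(κC)²` (and it is `≥ 0`);
* the transport and stretching densities of the ε-fold law and the fold-creation density
  `Theorems.SlicedKelvin.foldDensity v R ε` — by `2ε⁻¹κ²C³`, `ε⁻¹C`, `2ε⁻¹κ²C³ + εC`
  (`abs_foldDensity_le_decay`, the registered sub-goal).

Continuity in `x` of these integrands and their joint space–time regularity along a solution are in the
sibling file `…FoldLawSpaceTime`.
-/

noncomputable section

-- Problem = summit for this single-conjunct summit: the duplicate namespace component is deliberate.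
set_option linter.dupNamespace false

namespace Summit.NavierStokesRegularity.NavierStokesRegularity.Theorems.SlicedKelvinPlanarFluxAPriori

open MeasureTheory Set Filter Topology
open scoped RealInnerProductSpace Laplacian ContDiff
open Literature.Analysis.FluidPDE
open Summit.NavierStokesRegularity.NavierStokesRegularity.Theorems.SlicedKelvin

section Decay

variable {v : EuclideanSpace ℝ (Fin 3) → EuclideanSpace ℝ (Fin 3)} {C : ℝ}

/-- `‖v x‖ ≤ C (1 + ‖x‖)⁻³`. -/
theorem norm_le_decay (hC : ∀ (x : EuclideanSpace ℝ (Fin 3)) (k : ℕ), k ≤ 3 →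
      (1 + ‖x‖) ^ 3 * ‖iteratedFDeriv ℝ k v x‖ ≤ C) (x : EuclideanSpace ℝ (Fin 3)) :
    ‖v x‖ ≤ C * (1 + ‖x‖) ^ (-(3 : ℝ)) := by
  rw [← norm_iteratedFDeriv_zero (𝕜 := ℝ)]
  exact norm_iteratedFDeriv_le_of_decay hC (by norm_num) x

/-- `‖Dv x‖ ≤ C (1 + ‖x‖)⁻³`. -/
theorem norm_fderiv_le_decay (hC : ∀ (x : EuclideanSpace ℝ (Fin 3)) (k : ℕ), k ≤ 3 →
      (1 + ‖x‖) ^ 3 * ‖iteratedFDeriv ℝ k v x‖ ≤ C) (x : EuclideanSpace ℝ (Fin 3)) :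
    ‖fderiv ℝ v x‖ ≤ C * (1 + ‖x‖) ^ (-(3 : ℝ)) := by
  rw [norm_fderiv_eq_norm_iteratedFDeriv_one]
  exact norm_iteratedFDeriv_le_of_decay hC (by norm_num) x

/-- `‖curl v x‖ ≤ κC (1 + ‖x‖)⁻³`. -/
theorem norm_curl_le_decay (hC : ∀ (x : EuclideanSpace ℝ (Fin 3)) (k : ℕ), k ≤ 3 →
      (1 + ‖x‖) ^ 3 * ‖iteratedFDeriv ℝ k v x‖ ≤ C) (x : EuclideanSpace ℝ (Fin 3)) :
    ‖curl v x‖ ≤ ‖curlCLM‖ * C * (1 + ‖x‖) ^ (-(3 : ℝ)) := by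
  refine (norm_curl_le v x).trans ?_
  rw [mul_assoc]
  exact mul_le_mul_of_nonneg_left (norm_fderiv_le_decay hC x) (norm_nonneg curlCLM)

/-- `‖D(curl v)(x)‖ ≤ κC (1 + ‖x‖)⁻³`. -/
theorem norm_fderiv_curl_le_decay (hv : ContDiff ℝ ∞ v)
    (hC : ∀ (x : EuclideanSpace ℝ (Fin 3)) (k : ℕ), k ≤ 3 →
      (1 + ‖x‖) ^ 3 * ‖iteratedFDeriv ℝ k v x‖ ≤ C) (x : EuclideanSpace ℝ (Fin 3)) :
    ‖fderiv ℝ (curl v) x‖ ≤ ‖curlCLM‖ * C * (1 + ‖x‖) ^ (-(3 : ℝ)) := by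
  rw [norm_fderiv_eq_norm_iteratedFDeriv_one, mul_assoc]
  exact (norm_iteratedFDeriv_curl_le hv 1 x).trans
    (mul_le_mul_of_nonneg_left (norm_iteratedFDeriv_le_of_decay hC (by norm_num) x) (norm_nonneg curlCLM))

/-- `‖D²(curl v)(x)‖ ≤ κC (1 + ‖x‖)⁻³`. -/
theorem norm_fderiv_fderiv_curl_le_decay (hv : ContDiff ℝ ∞ v)
    (hC : ∀ (x : EuclideanSpace ℝ (Fin 3)) (k : ℕ), k ≤ 3 →
      (1 + ‖x‖) ^ 3 * ‖iteratedFDeriv ℝ k v x‖ ≤ C) (x : EuclideanSpace ℝ (Fin 3)) :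
    ‖fderiv ℝ (fderiv ℝ (curl v)) x‖ ≤ ‖curlCLM‖ * C * (1 + ‖x‖) ^ (-(3 : ℝ)) := by
  rw [norm_fderiv_fderiv_eq_norm_iteratedFDeriv_two, mul_assoc]
  exact (norm_iteratedFDeriv_curl_le hv 2 x).trans
    (mul_le_mul_of_nonneg_left (norm_iteratedFDeriv_le_of_decay hC (by norm_num) x) (norm_nonneg curlCLM))

variable {n : EuclideanSpace ℝ (Fin 3)}

/-- `|f x| ≤ κC (1 + ‖x‖)⁻³` for the normal vorticity `f = ⟪curl v, n⟫`, `‖n‖ = 1`. -/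
theorem abs_inner_curl_le_decay (hC : ∀ (x : EuclideanSpace ℝ (Fin 3)) (k : ℕ), k ≤ 3 →
      (1 + ‖x‖) ^ 3 * ‖iteratedFDeriv ℝ k v x‖ ≤ C) (hn : ‖n‖ = 1) (x : EuclideanSpace ℝ (Fin 3)) :
    |⟪curl v x, n⟫| ≤ ‖curlCLM‖ * C * (1 + ‖x‖) ^ (-(3 : ℝ)) :=
  (abs_inner_unit_le _ hn).trans (norm_curl_le_decay hC x)

/-- `‖Df(x)‖ ≤ κC (1 + ‖x‖)⁻³`. -/
theorem norm_fderiv_inner_curl_le_decay (hv : ContDiff ℝ ∞ v)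
    (hC : ∀ (x : EuclideanSpace ℝ (Fin 3)) (k : ℕ), k ≤ 3 →
      (1 + ‖x‖) ^ 3 * ‖iteratedFDeriv ℝ k v x‖ ≤ C) (hn : ‖n‖ = 1) (x : EuclideanSpace ℝ (Fin 3)) :
    ‖fderiv ℝ (fun x => ⟪curl v x, n⟫) x‖ ≤ ‖curlCLM‖ * C * (1 + ‖x‖) ^ (-(3 : ℝ)) := by
  rw [norm_fderiv_eq_norm_iteratedFDeriv_one, mul_assoc]
  exact (norm_iteratedFDeriv_inner_curl_le hv hn 1 x).trans
    (mul_le_mul_of_nonneg_left (norm_iteratedFDeriv_le_of_decay hC (by norm_num) x) (norm_nonneg curlCLM))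

/-- `‖D²f(x)‖ ≤ κC (1 + ‖x‖)⁻³`. -/
theorem norm_fderiv_fderiv_inner_curl_le_decay (hv : ContDiff ℝ ∞ v)
    (hC : ∀ (x : EuclideanSpace ℝ (Fin 3)) (k : ℕ), k ≤ 3 →
      (1 + ‖x‖) ^ 3 * ‖iteratedFDeriv ℝ k v x‖ ≤ C) (hn : ‖n‖ = 1) (x : EuclideanSpace ℝ (Fin 3)) :
    ‖fderiv ℝ (fderiv ℝ (fun x => ⟪curl v x, n⟫)) x‖ ≤ ‖curlCLM‖ * C * (1 + ‖x‖) ^ (-(3 : ℝ)) := by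
  rw [norm_fderiv_fderiv_eq_norm_iteratedFDeriv_two, mul_assoc]
  exact (norm_iteratedFDeriv_inner_curl_le hv hn 2 x).trans
    (mul_le_mul_of_nonneg_left (norm_iteratedFDeriv_le_of_decay hC (by norm_num) x) (norm_nonneg curlCLM))

variable {ε : ℝ}

/-- The regularised flux density decays: `|F_ε(f x) − ε| ≤ κC (1 + ‖x‖)⁻³` (`0 ≤ F_ε − ε ≤ |f|`). -/
theorem abs_sqrtReg_sub_le_decay (hC : ∀ (x : EuclideanSpace ℝ (Fin 3)) (k : ℕ), k ≤ 3 →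
      (1 + ‖x‖) ^ 3 * ‖iteratedFDeriv ℝ k v x‖ ≤ C) (hn : ‖n‖ = 1) (hε : 0 ≤ ε)
    (x : EuclideanSpace ℝ (Fin 3)) :
    |Real.sqrt (⟪curl v x, n⟫ ^ 2 + ε ^ 2) - ε| ≤ ‖curlCLM‖ * C * (1 + ‖x‖) ^ (-(3 : ℝ)) := by
  rw [abs_of_nonneg (sqrt_sq_add_sq_sub_nonneg _ hε)]
  exact (sqrt_sq_add_sq_sub_le_abs _ hε).trans (abs_inner_curl_le_decay hC hn x)

/-- `‖D(F_ε∘f)(x)‖ ≤ κC (1 + ‖x‖)⁻³`. -/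
theorem norm_fderiv_sqrtReg_le_decay (hv : ContDiff ℝ ∞ v)
    (hC : ∀ (x : EuclideanSpace ℝ (Fin 3)) (k : ℕ), k ≤ 3 →
      (1 + ‖x‖) ^ 3 * ‖iteratedFDeriv ℝ k v x‖ ≤ C) (hn : ‖n‖ = 1) (hε : 0 < ε)
    (x : EuclideanSpace ℝ (Fin 3)) :
    ‖fderiv ℝ (fun x => Real.sqrt (⟪curl v x, n⟫ ^ 2 + ε ^ 2)) x‖ ≤
      ‖curlCLM‖ * C * (1 + ‖x‖) ^ (-(3 : ℝ)) :=
  (norm_fderiv_sqrtReg_le hε ((contDiff_inner_curl hv n).differentiable (by simp)) x).trans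
    (norm_fderiv_inner_curl_le_decay hv hC hn x)

/-- `‖D(F_ε∘f − ε)(x)‖ ≤ κC (1 + ‖x‖)⁻³` (the constant drops out). -/
theorem norm_fderiv_sqrtReg_sub_le_decay (hv : ContDiff ℝ ∞ v)
    (hC : ∀ (x : EuclideanSpace ℝ (Fin 3)) (k : ℕ), k ≤ 3 →
      (1 + ‖x‖) ^ 3 * ‖iteratedFDeriv ℝ k v x‖ ≤ C) (hn : ‖n‖ = 1) (hε : 0 < ε)
    (x : EuclideanSpace ℝ (Fin 3)) :
    ‖fderiv ℝ (fun x => Real.sqrt (⟪curl v x, n⟫ ^ 2 + ε ^ 2) - ε) x‖ ≤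
      ‖curlCLM‖ * C * (1 + ‖x‖) ^ (-(3 : ℝ)) := by
  rw [fderiv_sub_const]
  exact norm_fderiv_sqrtReg_le_decay hv hC hn hε x

/-- `|D(F_ε∘f)(x)[n]| ≤ κC (1 + ‖x‖)⁻³`. -/
theorem abs_fderiv_sqrtReg_apply_le_decay (hv : ContDiff ℝ ∞ v)
    (hC : ∀ (x : EuclideanSpace ℝ (Fin 3)) (k : ℕ), k ≤ 3 →
      (1 + ‖x‖) ^ 3 * ‖iteratedFDeriv ℝ k v x‖ ≤ C) (hn : ‖n‖ = 1) (hε : 0 < ε)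
    (x : EuclideanSpace ℝ (Fin 3)) :
    |fderiv ℝ (fun x => Real.sqrt (⟪curl v x, n⟫ ^ 2 + ε ^ 2)) x n| ≤
      ‖curlCLM‖ * C * (1 + ‖x‖) ^ (-(3 : ℝ)) :=
  (abs_fderiv_sqrtReg_apply_le hε ((contDiff_inner_curl hv n).differentiable (by simp)) x hn).trans
    (norm_fderiv_inner_curl_le_decay hv hC hn x)

/-- The second-derivative decay: `‖D²f‖ + ε⁻¹‖Df‖² ≤ (κC + ε⁻¹(κC)²) (1 + ‖x‖)⁻³`. -/
theorem second_order_le_decay (hv : ContDiff ℝ ∞ v)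
    (hC : ∀ (x : EuclideanSpace ℝ (Fin 3)) (k : ℕ), k ≤ 3 →
      (1 + ‖x‖) ^ 3 * ‖iteratedFDeriv ℝ k v x‖ ≤ C) (hn : ‖n‖ = 1) (hε : 0 < ε)
    (x : EuclideanSpace ℝ (Fin 3)) :
    ‖fderiv ℝ (fderiv ℝ (fun x => ⟪curl v x, n⟫)) x‖ +
        ε⁻¹ * ‖fderiv ℝ (fun x => ⟪curl v x, n⟫) x‖ ^ 2 ≤
      (‖curlCLM‖ * C + ε⁻¹ * (‖curlCLM‖ * C) ^ 2) * (1 + ‖x‖) ^ (-(3 : ℝ)) := by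
  have hκC : 0 ≤ ‖curlCLM‖ * C := mul_nonneg (norm_nonneg curlCLM) (decay_const_nonneg hC)
  have h1 := norm_fderiv_inner_curl_le_decay hv hC hn x
  have h2 := norm_fderiv_fderiv_inner_curl_le_decay hv hC hn x
  have h3 : ‖fderiv ℝ (fun x => ⟪curl v x, n⟫) x‖ ^ 2 ≤
      (‖curlCLM‖ * C) ^ 2 * (1 + ‖x‖) ^ (-(3 : ℝ)) := by
    calc ‖fderiv ℝ (fun x => ⟪curl v x, n⟫) x‖ ^ 2
        ≤ (‖curlCLM‖ * C * (1 + ‖x‖) ^ (-(3 : ℝ))) ^ 2 := by gcongr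
      _ = ‖curlCLM‖ * C * (1 + ‖x‖) ^ (-(3 : ℝ)) * (‖curlCLM‖ * C * (1 + ‖x‖) ^ (-(3 : ℝ))) := sq _
      _ ≤ ‖curlCLM‖ * C * (‖curlCLM‖ * C) * (1 + ‖x‖) ^ (-(3 : ℝ)) :=
          mul_weight_mul_weight_le x hκC hκC
      _ = (‖curlCLM‖ * C) ^ 2 * (1 + ‖x‖) ^ (-(3 : ℝ)) := by ring
  calc _ ≤ ‖curlCLM‖ * C * (1 + ‖x‖) ^ (-(3 : ℝ)) +
        ε⁻¹ * ((‖curlCLM‖ * C) ^ 2 * (1 + ‖x‖) ^ (-(3 : ℝ))) :=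
          add_le_add h2 (mul_le_mul_of_nonneg_left h3 (inv_nonneg.2 hε.le))
    _ = _ := by ring

/-- `‖D(D(F_ε∘f)[n])(x)‖ ≤ (κC + ε⁻¹(κC)²) (1 + ‖x‖)⁻³`. -/
theorem norm_fderiv_fderiv_sqrtReg_apply_le_decay (hv : ContDiff ℝ ∞ v)
    (hC : ∀ (x : EuclideanSpace ℝ (Fin 3)) (k : ℕ), k ≤ 3 →
      (1 + ‖x‖) ^ 3 * ‖iteratedFDeriv ℝ k v x‖ ≤ C) (hn : ‖n‖ = 1) (hε : 0 < ε)
    (x : EuclideanSpace ℝ (Fin 3)) :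
    ‖fderiv ℝ (fun x => fderiv ℝ (fun x => Real.sqrt (⟪curl v x, n⟫ ^ 2 + ε ^ 2)) x n) x‖ ≤
      (‖curlCLM‖ * C + ε⁻¹ * (‖curlCLM‖ * C) ^ 2) * (1 + ‖x‖) ^ (-(3 : ℝ)) :=
  (norm_fderiv_fderiv_sqrtReg_apply_le hε ((contDiff_inner_curl hv n).of_le (by norm_cast))
    x hn).trans (second_order_le_decay hv hC hn hε x)

/-- `|D(D(F_ε∘f)[n])(x)[n]| ≤ (κC + ε⁻¹(κC)²) (1 + ‖x‖)⁻³`. -/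
theorem abs_fderiv_fderiv_sqrtReg_apply_apply_le_decay (hv : ContDiff ℝ ∞ v)
    (hC : ∀ (x : EuclideanSpace ℝ (Fin 3)) (k : ℕ), k ≤ 3 →
      (1 + ‖x‖) ^ 3 * ‖iteratedFDeriv ℝ k v x‖ ≤ C) (hn : ‖n‖ = 1) (hε : 0 < ε)
    (x : EuclideanSpace ℝ (Fin 3)) :
    |fderiv ℝ (fun x => fderiv ℝ (fun x => Real.sqrt (⟪curl v x, n⟫ ^ 2 + ε ^ 2)) x n) x n| ≤
      (‖curlCLM‖ * C + ε⁻¹ * (‖curlCLM‖ * C) ^ 2) * (1 + ‖x‖) ^ (-(3 : ℝ)) :=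
  (abs_fderiv_fderiv_sqrtReg_apply_apply_le hε ((contDiff_inner_curl hv n).of_le (by norm_cast))
    x hn).trans (second_order_le_decay hv hC hn hε x)

/-- **Decay of the vorticity tendency** `w = νΔω − (v·∇)ω + (ω·∇)v`:
`‖w x‖ ≤ (3|ν|κC + 2κC²) (1 + ‖x‖)⁻³`. -/
theorem norm_tendency_le_decay (hv : ContDiff ℝ ∞ v)
    (hC : ∀ (x : EuclideanSpace ℝ (Fin 3)) (k : ℕ), k ≤ 3 →
      (1 + ‖x‖) ^ 3 * ‖iteratedFDeriv ℝ k v x‖ ≤ C) (ν : ℝ) (x : EuclideanSpace ℝ (Fin 3)) :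
    ‖ν • Δ (curl v) x - convect v (curl v) x + convect (curl v) v x‖ ≤
      (3 * |ν| * (‖curlCLM‖ * C) + 2 * ‖curlCLM‖ * C ^ 2) * (1 + ‖x‖) ^ (-(3 : ℝ)) := by
  have hC0 : 0 ≤ C := decay_const_nonneg hC
  have hκC : 0 ≤ ‖curlCLM‖ * C := mul_nonneg (norm_nonneg curlCLM) hC0
  -- the three terms
  have hΔ : ‖ν • Δ (curl v) x‖ ≤ |ν| * (3 * (‖curlCLM‖ * C * (1 + ‖x‖) ^ (-(3 : ℝ)))) := by
    rw [norm_smul, Real.norm_eq_abs]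
    refine mul_le_mul_of_nonneg_left ?_ (abs_nonneg _)
    have h := norm_laplacian_le (curl v) x
    rw [finrank_euclideanSpace_fin, Nat.cast_ofNat] at h
    exact h.trans (mul_le_mul_of_nonneg_left (norm_fderiv_fderiv_curl_le_decay hv hC x) (by norm_num))
  have hT : ‖convect v (curl v) x‖ ≤ ‖curlCLM‖ * C * C * (1 + ‖x‖) ^ (-(3 : ℝ)) := by
    rw [convect_apply]
    calc ‖fderiv ℝ (curl v) x (v x)‖ ≤ ‖fderiv ℝ (curl v) x‖ * ‖v x‖ := ContinuousLinearMap.le_opNorm _ _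
      _ ≤ ‖curlCLM‖ * C * (1 + ‖x‖) ^ (-(3 : ℝ)) * (C * (1 + ‖x‖) ^ (-(3 : ℝ))) :=
          mul_le_mul (norm_fderiv_curl_le_decay hv hC x) (norm_le_decay hC x) (norm_nonneg _)
            (mul_nonneg hκC (by positivity))
      _ ≤ _ := mul_weight_mul_weight_le x hκC hC0
  have hS : ‖convect (curl v) v x‖ ≤ C * (‖curlCLM‖ * C) * (1 + ‖x‖) ^ (-(3 : ℝ)) := by
    rw [convect_apply]
    calc ‖fderiv ℝ v x (curl v x)‖ ≤ ‖fderiv ℝ v x‖ * ‖curl v x‖ := ContinuousLinearMap.le_opNorm _ _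
      _ ≤ C * (1 + ‖x‖) ^ (-(3 : ℝ)) * (‖curlCLM‖ * C * (1 + ‖x‖) ^ (-(3 : ℝ))) :=
          mul_le_mul (norm_fderiv_le_decay hC x) (norm_curl_le_decay hC x) (norm_nonneg _)
            (mul_nonneg hC0 (by positivity))
      _ ≤ _ := mul_weight_mul_weight_le x hC0 hκC
  calc ‖ν • Δ (curl v) x - convect v (curl v) x + convect (curl v) v x‖
      ≤ ‖ν • Δ (curl v) x‖ + ‖convect v (curl v) x‖ + ‖convect (curl v) v x‖ :=
        norm_add_le_of_le (norm_sub_le _ _) le_rfl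
    _ ≤ |ν| * (3 * (‖curlCLM‖ * C * (1 + ‖x‖) ^ (-(3 : ℝ)))) +
        ‖curlCLM‖ * C * C * (1 + ‖x‖) ^ (-(3 : ℝ)) + C * (‖curlCLM‖ * C) * (1 + ‖x‖) ^ (-(3 : ℝ)) :=
        add_le_add (add_le_add hΔ hT) hS
    _ = _ := by ring

/-- **Decay of the time density** `F_ε'(f)⟪w, n⟫` (`|F_ε'| ≤ 1`, `‖n‖ = 1`). -/
theorem abs_timeDensity_le_decay (hv : ContDiff ℝ ∞ v)
    (hC : ∀ (x : EuclideanSpace ℝ (Fin 3)) (k : ℕ), k ≤ 3 →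
      (1 + ‖x‖) ^ 3 * ‖iteratedFDeriv ℝ k v x‖ ≤ C) (hn : ‖n‖ = 1) (ν ε : ℝ)
    (x : EuclideanSpace ℝ (Fin 3)) :
    |⟪curl v x, n⟫ / Real.sqrt (⟪curl v x, n⟫ ^ 2 + ε ^ 2) *
        ⟪ν • Δ (curl v) x - convect v (curl v) x + convect (curl v) v x, n⟫| ≤
      (3 * |ν| * (‖curlCLM‖ * C) + 2 * ‖curlCLM‖ * C ^ 2) * (1 + ‖x‖) ^ (-(3 : ℝ)) := by
  rw [abs_mul]
  calc _ ≤ 1 * ‖ν • Δ (curl v) x - convect v (curl v) x + convect (curl v) v x‖ :=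
        mul_le_mul (abs_div_sqrt_sq_add_sq_le_one _ _) (abs_inner_unit_le _ hn) (abs_nonneg _)
          zero_le_one
    _ ≤ _ := by rw [one_mul]; exact norm_tendency_le_decay hv hC ν x

/-- The annihilation density `F_ε''(f)|∇f|²` is nonnegative. -/
theorem annihilationDensity_nonneg (ε : ℝ) (e₀ e₁ : EuclideanSpace ℝ (Fin 3))
    (x : EuclideanSpace ℝ (Fin 3)) :
    0 ≤ ε ^ 2 / Real.sqrt (⟪curl v x, n⟫ ^ 2 + ε ^ 2) ^ 3 *
      (fderiv ℝ (fun x => ⟪curl v x, n⟫) x e₀ ^ 2 + fderiv ℝ (fun x => ⟪curl v x, n⟫) x e₁ ^ 2 +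
        fderiv ℝ (fun x => ⟪curl v x, n⟫) x n ^ 2) := by
  positivity

/-- A directional derivative squared is controlled by the decay of `Df`:
`(Df(x)[e])² ≤ (κC)² (1 + ‖x‖)⁻³` for a unit vector `e`. -/
theorem sq_fderiv_inner_curl_apply_le_decay (hv : ContDiff ℝ ∞ v)
    (hC : ∀ (x : EuclideanSpace ℝ (Fin 3)) (k : ℕ), k ≤ 3 →
      (1 + ‖x‖) ^ 3 * ‖iteratedFDeriv ℝ k v x‖ ≤ C) (hn : ‖n‖ = 1) {e : EuclideanSpace ℝ (Fin 3)}
    (he : ‖e‖ = 1) (x : EuclideanSpace ℝ (Fin 3)) :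
    fderiv ℝ (fun x => ⟪curl v x, n⟫) x e ^ 2 ≤ (‖curlCLM‖ * C) ^ 2 * (1 + ‖x‖) ^ (-(3 : ℝ)) := by
  have hκC : 0 ≤ ‖curlCLM‖ * C := mul_nonneg (norm_nonneg curlCLM) (decay_const_nonneg hC)
  have h1 : |fderiv ℝ (fun x => ⟪curl v x, n⟫) x e| ≤ ‖curlCLM‖ * C * (1 + ‖x‖) ^ (-(3 : ℝ)) := by
    rw [← Real.norm_eq_abs]
    calc _ ≤ ‖fderiv ℝ (fun x => ⟪curl v x, n⟫) x‖ * ‖e‖ := ContinuousLinearMap.le_opNorm _ _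
      _ ≤ _ := by rw [he, mul_one]; exact norm_fderiv_inner_curl_le_decay hv hC hn x
  calc fderiv ℝ (fun x => ⟪curl v x, n⟫) x e ^ 2
      = |fderiv ℝ (fun x => ⟪curl v x, n⟫) x e| ^ 2 := (sq_abs _).symm
    _ ≤ (‖curlCLM‖ * C * (1 + ‖x‖) ^ (-(3 : ℝ))) ^ 2 := by gcongr
    _ = ‖curlCLM‖ * C * (1 + ‖x‖) ^ (-(3 : ℝ)) * (‖curlCLM‖ * C * (1 + ‖x‖) ^ (-(3 : ℝ))) := sq _
    _ ≤ ‖curlCLM‖ * C * (‖curlCLM‖ * C) * (1 + ‖x‖) ^ (-(3 : ℝ)) := mul_weight_mul_weight_le x hκC hκC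
    _ = _ := by ring

/-- **Decay of the annihilation density** `F_ε''(f)|∇f|² ≤ 3ε⁻¹(κC)² (1 + ‖x‖)⁻³` (in the frame
`e₀, e₁, n` of unit vectors). -/
theorem annihilationDensity_le_decay (hv : ContDiff ℝ ∞ v)
    (hC : ∀ (x : EuclideanSpace ℝ (Fin 3)) (k : ℕ), k ≤ 3 →
      (1 + ‖x‖) ^ 3 * ‖iteratedFDeriv ℝ k v x‖ ≤ C) (hn : ‖n‖ = 1) (hε : 0 < ε)
    {e₀ e₁ : EuclideanSpace ℝ (Fin 3)} (he₀ : ‖e₀‖ = 1) (he₁ : ‖e₁‖ = 1) (x : EuclideanSpace ℝ (Fin 3)) :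
    ε ^ 2 / Real.sqrt (⟪curl v x, n⟫ ^ 2 + ε ^ 2) ^ 3 *
      (fderiv ℝ (fun x => ⟪curl v x, n⟫) x e₀ ^ 2 + fderiv ℝ (fun x => ⟪curl v x, n⟫) x e₁ ^ 2 +
        fderiv ℝ (fun x => ⟪curl v x, n⟫) x n ^ 2) ≤
      3 * ε⁻¹ * (‖curlCLM‖ * C) ^ 2 * (1 + ‖x‖) ^ (-(3 : ℝ)) := by
  have h0 := sq_fderiv_inner_curl_apply_le_decay hv hC hn he₀ x
  have h1 := sq_fderiv_inner_curl_apply_le_decay hv hC hn he₁ x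
  have h2 := sq_fderiv_inner_curl_apply_le_decay hv hC hn hn x
  calc _ ≤ ε⁻¹ * (3 * ((‖curlCLM‖ * C) ^ 2 * (1 + ‖x‖) ^ (-(3 : ℝ)))) := by
        refine mul_le_mul (sq_div_sqrt_cube_le hε _) (by linarith) (by positivity) (inv_nonneg.2 hε.le)
    _ = _ := by ring

/-- **Decay of the transport density** `⟪v, n⟫ F_ε''(f) (⟪ω, e₀⟫Df[e₀] + ⟪ω, e₁⟫Df[e₁])`:
bounded by `2ε⁻¹κ²C³ (1 + ‖x‖)⁻³`. -/
theorem abs_transportDensity_le_decay (hv : ContDiff ℝ ∞ v)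
    (hC : ∀ (x : EuclideanSpace ℝ (Fin 3)) (k : ℕ), k ≤ 3 →
      (1 + ‖x‖) ^ 3 * ‖iteratedFDeriv ℝ k v x‖ ≤ C) (hn : ‖n‖ = 1) (hε : 0 < ε)
    {e₀ e₁ : EuclideanSpace ℝ (Fin 3)} (he₀ : ‖e₀‖ = 1) (he₁ : ‖e₁‖ = 1) (x : EuclideanSpace ℝ (Fin 3)) :
    |⟪v x, n⟫ * (ε ^ 2 / Real.sqrt (⟪curl v x, n⟫ ^ 2 + ε ^ 2) ^ 3) *
        (⟪curl v x, e₀⟫ * fderiv ℝ (fun x => ⟪curl v x, n⟫) x e₀ +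
          ⟪curl v x, e₁⟫ * fderiv ℝ (fun x => ⟪curl v x, n⟫) x e₁)| ≤
      2 * ε⁻¹ * ‖curlCLM‖ ^ 2 * C ^ 3 * (1 + ‖x‖) ^ (-(3 : ℝ)) := by
  have hC0 : 0 ≤ C := decay_const_nonneg hC
  have hκC : 0 ≤ ‖curlCLM‖ * C := mul_nonneg (norm_nonneg curlCLM) hC0
  have hw : 0 ≤ (1 + ‖x‖) ^ (-(3 : ℝ)) := by positivity
  -- one in-plane term
  have hterm : ∀ {e : EuclideanSpace ℝ (Fin 3)}, ‖e‖ = 1 →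
      |⟪curl v x, e⟫ * fderiv ℝ (fun x => ⟪curl v x, n⟫) x e| ≤
        ‖curlCLM‖ * C * (‖curlCLM‖ * C) * (1 + ‖x‖) ^ (-(3 : ℝ)) := by
    intro e he
    rw [abs_mul]
    have ha : |⟪curl v x, e⟫| ≤ ‖curlCLM‖ * C * (1 + ‖x‖) ^ (-(3 : ℝ)) :=
      (abs_inner_unit_le _ he).trans (norm_curl_le_decay hC x)
    have hb : |fderiv ℝ (fun x => ⟪curl v x, n⟫) x e| ≤ ‖curlCLM‖ * C * (1 + ‖x‖) ^ (-(3 : ℝ)) := by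
      rw [← Real.norm_eq_abs]
      calc _ ≤ ‖fderiv ℝ (fun x => ⟪curl v x, n⟫) x‖ * ‖e‖ := ContinuousLinearMap.le_opNorm _ _
        _ ≤ _ := by rw [he, mul_one]; exact norm_fderiv_inner_curl_le_decay hv hC hn x
    calc _ ≤ ‖curlCLM‖ * C * (1 + ‖x‖) ^ (-(3 : ℝ)) * (‖curlCLM‖ * C * (1 + ‖x‖) ^ (-(3 : ℝ))) :=
          mul_le_mul ha hb (abs_nonneg _) (mul_nonneg hκC hw)
      _ ≤ _ := mul_weight_mul_weight_le x hκC hκC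
  have hsum : |⟪curl v x, e₀⟫ * fderiv ℝ (fun x => ⟪curl v x, n⟫) x e₀ +
      ⟪curl v x, e₁⟫ * fderiv ℝ (fun x => ⟪curl v x, n⟫) x e₁| ≤
      2 * (‖curlCLM‖ * C * (‖curlCLM‖ * C)) * (1 + ‖x‖) ^ (-(3 : ℝ)) := by
    refine (abs_add_le _ _).trans ?_
    have := add_le_add (hterm he₀) (hterm he₁)
    linarith
  have hvn : |⟪v x, n⟫| ≤ C * (1 + ‖x‖) ^ (-(3 : ℝ)) := (abs_inner_unit_le _ hn).trans (norm_le_decay hC x)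
  rw [abs_mul, abs_mul, abs_of_nonneg (sq_div_sqrt_cube_nonneg _ _)]
  calc _ ≤ C * (1 + ‖x‖) ^ (-(3 : ℝ)) * ε⁻¹ *
        (2 * (‖curlCLM‖ * C * (‖curlCLM‖ * C)) * (1 + ‖x‖) ^ (-(3 : ℝ))) := by
        refine mul_le_mul (mul_le_mul hvn (sq_div_sqrt_cube_le hε _) (sq_div_sqrt_cube_nonneg _ _)
          (mul_nonneg hC0 hw)) hsum (abs_nonneg _) ?_
        exact mul_nonneg (mul_nonneg hC0 hw) (inv_nonneg.2 hε.le)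
    _ = 2 * ε⁻¹ * ‖curlCLM‖ ^ 2 * C ^ 3 *
        ((1 + ‖x‖) ^ (-(3 : ℝ)) * (1 + ‖x‖) ^ (-(3 : ℝ))) := by ring
    _ ≤ 2 * ε⁻¹ * ‖curlCLM‖ ^ 2 * C ^ 3 * (1 + ‖x‖) ^ (-(3 : ℝ)) := by
        have hc : 0 ≤ 2 * ε⁻¹ * ‖curlCLM‖ ^ 2 * C ^ 3 := by positivity
        have hww : (1 + ‖x‖) ^ (-(3 : ℝ)) * (1 + ‖x‖) ^ (-(3 : ℝ)) ≤ (1 + ‖x‖) ^ (-(3 : ℝ)) := by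
          calc _ ≤ (1 + ‖x‖) ^ (-(3 : ℝ)) * 1 := mul_le_mul_of_nonneg_left (rpow_neg_three_le_one x) hw
            _ = _ := mul_one _
        exact mul_le_mul_of_nonneg_left hww hc

/-- **Decay of the stretching density** `D⟪v, n⟫[n] / F_ε(f)`: bounded by `ε⁻¹C (1 + ‖x‖)⁻³`. -/
theorem abs_stretchDensity_le_decay (hv : ContDiff ℝ ∞ v)
    (hC : ∀ (x : EuclideanSpace ℝ (Fin 3)) (k : ℕ), k ≤ 3 →
      (1 + ‖x‖) ^ 3 * ‖iteratedFDeriv ℝ k v x‖ ≤ C) (hn : ‖n‖ = 1) (hε : 0 < ε)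
    (x : EuclideanSpace ℝ (Fin 3)) :
    |fderiv ℝ (fun z => ⟪v z, n⟫) x n / Real.sqrt (⟪curl v x, n⟫ ^ 2 + ε ^ 2)| ≤
      ε⁻¹ * C * (1 + ‖x‖) ^ (-(3 : ℝ)) := by
  have hF := sqrt_sq_add_sq_pos hε ⟪curl v x, n⟫
  have hnum : |fderiv ℝ (fun z => ⟪v z, n⟫) x n| ≤ C * (1 + ‖x‖) ^ (-(3 : ℝ)) := by
    rw [← Real.norm_eq_abs]
    calc _ ≤ ‖fderiv ℝ (fun z => ⟪v z, n⟫) x‖ * ‖n‖ := ContinuousLinearMap.le_opNorm _ _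
      _ ≤ ‖fderiv ℝ v x‖ := by
          rw [hn, mul_one]
          exact norm_fderiv_inner_const_le ((hv.differentiable (by simp)) x) hn
      _ ≤ _ := norm_fderiv_le_decay hC x
  rw [abs_div, abs_of_pos hF, div_le_iff₀ hF]
  refine hnum.trans ?_
  have hle := le_sqrt_sq_add_sq hε.le ⟪curl v x, n⟫
  have hC0 : 0 ≤ C := decay_const_nonneg hC
  calc C * (1 + ‖x‖) ^ (-(3 : ℝ)) = ε⁻¹ * C * (1 + ‖x‖) ^ (-(3 : ℝ)) * ε := by field_simp
    _ ≤ ε⁻¹ * C * (1 + ‖x‖) ^ (-(3 : ℝ)) * Real.sqrt (⟪curl v x, n⟫ ^ 2 + ε ^ 2) :=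
        mul_le_mul_of_nonneg_left hle (mul_nonneg (mul_nonneg (inv_nonneg.2 hε.le) hC0) (by positivity))

/-- **Decay of the ε-regularised fold-creation density** (registered sub-goal of `stub_foldLawPackage`):
for a smooth field `v` with `(1 + ‖x‖)³‖Dᵏv‖ ≤ C` (`k ≤ 3`), a frame `R` and `ε > 0`,
`|s_ε(v; R)(x)| ≤ (2ε⁻¹‖curlCLM‖²C³ + εC)(1 + ‖x‖)⁻³`. -/
theorem abs_foldDensity_le_decay : ∀ (v : EuclideanSpace ℝ (Fin 3) → EuclideanSpace ℝ (Fin 3)) (C ε : ℝ) (R : EuclideanSpace ℝ (Fin 3) ≃ₗᵢ[ℝ] EuclideanSpace ℝ (Fin 3)), ContDiff ℝ (⊤ : ℕ∞) v → (∀ (x : EuclideanSpace ℝ (Fin 3)) (k : ℕ), k ≤ 3 → (1 + ‖x‖) ^ 3 * ‖iteratedFDeriv ℝ k v x‖ ≤ C) → 0 < ε → ∀ (x : EuclideanSpace ℝ (Fin 3)), |Summit.NavierStokesRegularity.NavierStokesRegularity.Theorems.SlicedKelvin.foldDensity v R ε x| ≤ (2 * ε⁻¹ * ‖Literature.Analysis.FluidPDE.curlCLM‖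 ^ 2 * C ^ 3 + ε * C) * (1 + ‖x‖) ^ (-(3 : ℝ)) := by
  intro v C ε R hv hC hε x
  have hn := norm_frame R 2
  have h1 := abs_transportDensity_le_decay hv hC hn hε (norm_frame R 0) (norm_frame R 1) x
  have h2 := abs_stretchDensity_le_decay hv hC hn hε x
  have hεε : ε ^ 2 * ε⁻¹ = ε := by rw [sq, mul_assoc, mul_inv_cancel₀ hε.ne', mul_one]
  unfold foldDensity
  rw [neg_mul, neg_mul, mul_div_assoc]
  refine (abs_sub _ _).trans ?_
  rw [abs_neg, abs_mul (ε ^ 2), abs_of_nonneg (sq_nonneg ε)]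
  calc _ ≤ 2 * ε⁻¹ * ‖curlCLM‖ ^ 2 * C ^ 3 * (1 + ‖x‖) ^ (-(3 : ℝ)) +
        ε ^ 2 * (ε⁻¹ * C * (1 + ‖x‖) ^ (-(3 : ℝ))) := add_le_add h1 (mul_le_mul_of_nonneg_left h2 (sq_nonneg _))
    _ = (2 * ε⁻¹ * ‖curlCLM‖ ^ 2 * C ^ 3 + ε ^ 2 * ε⁻¹ * C) * (1 + ‖x‖) ^ (-(3 : ℝ)) := by ring
    _ = _ := by rw [hεε]

end Decay

end Summit.NavierStokesRegularity.NavierStokesRegularity.Theorems.SlicedKelvinPlanarFluxAPriori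

end
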